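import Summits.Ventures.PercRepro.S1TriangleKernelFiveLemmas

/-!
# PercRepro — THE TRIANGLE KERNEL AT NULLITY `5`: `s₃ ≤ 8` under (C1) and (C2) (p8, gen 23; a feeder for S4 — the
top of the `q = 7` window, the row `38`)

The re-based bootstrap (S1TriangleCountBootSix) gives `s₃ ≤ triBound6 5 = 9` at nullity `5`. The value `9` is never
attained. At the point `x` on the fewest triangles (`m := t_x`): `s₃ ≤ m + s₃(M ＼ {x}) ≤ m + 6` (the kernel at nullity
`4`) and `m(2m + 1) ≤ |U|·m ≤ 3·s₃` on `U := ⋃ triangles` force, for `s₃ = 9`, `m = 3` and `7 ≤ |U| ≤ 9`. The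
restriction `M ↾ U` has the same triangles, so its nullity `d_U` satisfies `9 ≤ triBound6 d_U`, i.e. `d_U ≥ 5`, and with
`r(U) ≥ 4` (seven points are not a plane, (C2)) this gives `|U| = 9`: the star of `x` (`7` points) plus two points
`q, q'`, and every point of `U` lies on exactly `3` triangles (the strict double count). The triangles through `q` avoid
`x` and meet each triangle `Cᵢ` through `x` in at most one point. THE TYPE-FINDING STEP (a pigeonhole): if a triangle
`{q, q', a}` through both exists, `a ∈ C_k`, the two other triangles through `q` avoid `q'` and `a`, so if each met
`C_k` they would share its one remaining point — hence one of them lies in `Cᵢ ∪ Cⱼ` (`{i, j, k} = {1, 2, 3}`); if no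
triangle contains both, the three triangles through `q` avoid `q'`, and if each met `C₁` two of them would share one of
its two points off `x` — hence one lies in `C₂ ∪ C₃`. The same for `q'` with the same pair, so `q, q' ∈ cl(Cᵢ ∪ Cⱼ)`:
a set of rank `≤ 3` (submodularity at `Cᵢ ∩ Cⱼ = {x}`) with `7` points, against (C2). Hence **`s₃ ≤ 8` at nullity
`5`** (`ncard_triangles_le_eight_of_nullity_five`; the lemmas in S1TriangleKernelFiveLemmas). Axioms: standard.
-/

open scoped Matroid

namespace PercRepro

namespace S1

open Set

variable {α : Type}

/-- **THE TRIANGLE KERNEL AT NULLITY `5`.** If `|E| = r(E) + 5`, every rank-`2` set has at most `3` elements (C1) and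
every rank-`≤ 3` set has at most `6` elements (C2), then `#(triangles M) ≤ 8`. -/
theorem ncard_triangles_le_eight_of_nullity_five (M : Matroid α) [M.Finite]
    (hC1 : ∀ L ⊆ M.E, M.eRk L = 2 → L.ncard ≤ 3)
    (hC2 : ∀ X ⊆ M.E, M.eRk X ≤ 3 → X.ncard ≤ 6)
    (hd : M.E.encard = M.eRank + 5) : (ThmN.triangles M).ncard ≤ 8 := by
  classical
  set S := ThmN.triangles M with hS
  have hSfin : S.Finite :=
    M.ground_finite.finite_subsets.subset (fun C hC => hC.1.subset_ground)
  by_cases hSe : S = ∅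
  · rw [hSe, ncard_empty]; exact Nat.zero_le _
  -- the point on the fewest triangles
  have hUE : ⋃₀ S ⊆ M.E := by
    intro z hz
    obtain ⟨C, hC, hzC⟩ := Set.mem_sUnion.1 hz
    exact hC.1.subset_ground hzC
  have hUfin : (⋃₀ S).Finite := M.ground_finite.subset hUE
  set Uf : Finset α := hUfin.toFinset with hUf
  have hmemU : ∀ x, x ∈ Uf ↔ x ∈ ⋃₀ S := fun x => Set.Finite.mem_toFinset hUfin
  have hUne : Uf.Nonempty := by
    obtain ⟨C₀, hC₀⟩ := nonempty_iff_ne_empty.2 hSe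
    obtain ⟨e, heC₀⟩ := hC₀.1.nonempty
    exact ⟨e, (hmemU e).2 (Set.mem_sUnion.2 ⟨C₀, hC₀, heC₀⟩)⟩
  obtain ⟨x, hxU, hxmin⟩ := Finset.exists_min_image Uf (fun y => (ThmN.trianglesThrough M y).ncard) hUne
  have hxU' : x ∈ ⋃₀ S := (hmemU x).1 hxU
  obtain ⟨C₀, hC₀, hxC₀⟩ := Set.mem_sUnion.1 hxU'
  set m := (ThmN.trianglesThrough M x).ncard with hm
  have hmin : ∀ y ∈ ⋃₀ ThmN.triangles M, m ≤ (ThmN.trianglesThrough M y).ncard :=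
    fun y hy => hxmin y ((hmemU y).2 hy)
  have heE : x ∈ M.E := hC₀.1.subset_ground hxC₀
  have hne : ¬ M.IsColoop x := hC₀.1.not_isColoop_of_mem hxC₀
  have hx : M.IsNonloop x := by
    refine _root_.Matroid.isNonloop_of_not_isLoop heE ?_
    intro hloop
    have hC₀e : C₀ = {x} := hloop.eq_of_isCircuit_mem hC₀.1 hxC₀
    have := hC₀.2
    rw [hC₀e, ncard_singleton] at this
    omega
  -- the nullity of `M ＼ {x}` is `4`
  have hν : M✶.eRank = (5 : ℕ∞) := by
    have h := _root_.Matroid.eRank_add_eRank_dual M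
    rw [hd] at h
    exact WithTop.add_left_cancel (PercRepro.Matroid.eRank_ne_top_of_finite M) h
  have hdel := PercRepro.Matroid.dual_eRank_delete_singleton_add_one heE hne
  rw [hν] at hdel
  have hfin' : (M ＼ {x})✶.eRank ≠ ⊤ := by
    intro h
    rw [h] at hdel
    exact absurd hdel (by simp)
  obtain ⟨d', hd'⟩ := ENat.ne_top_iff_exists.1 hfin'
  have hdd' : d' + 1 = 5 := by
    rw [← hd'] at hdel
    exact_mod_cast hdel
  have hd'4 : d' = 4 := by omega
  have hd'enc : (M ＼ {x}).E.encard = (M ＼ {x}).eRank + d' := by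
    have h := _root_.Matroid.eRank_add_eRank_dual (M ＼ {x})
    rw [← hd'] at h
    exact h.symm
  have hC1' : ∀ L ⊆ (M ＼ {x}).E, (M ＼ {x}).eRk L = 2 → L.ncard ≤ 3 := by
    intro L hL hr
    rw [_root_.Matroid.delete_ground] at hL
    rw [delete_singleton_eRk_eq hL] at hr
    exact hC1 L (hL.trans sdiff_subset) hr
  have hC2' : ∀ X ⊆ (M ＼ {x}).E, (M ＼ {x}).eRk X ≤ 3 → X.ncard ≤ 6 := by
    intro X hX hr
    rw [_root_.Matroid.delete_ground] at hX
    rw [delete_singleton_eRk_eq hX] at hr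
    exact hC2 X (hX.trans sdiff_subset) hr
  -- (a) `s₃ ≤ m + 6`
  set S₁ := ThmN.trianglesThrough M x with hS₁
  set S₂ := {C | M.IsCircuit C ∧ C.ncard = 3 ∧ x ∉ C} with hS₂
  have hsplit : S ⊆ S₁ ∪ S₂ := by
    intro C hC
    by_cases h : x ∈ C
    · exact Or.inl ⟨hC.1, hC.2, h⟩
    · exact Or.inr ⟨hC.1, hC.2, h⟩
  have hS₁fin : S₁.Finite := hSfin.subset (fun C hC => ⟨hC.1, hC.2.1⟩)
  have hS₂fin : S₂.Finite := hSfin.subset (fun C hC => ⟨hC.1, hC.2.1⟩)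
  have h3 : S.ncard ≤ S₁.ncard + S₂.ncard :=
    (ncard_le_ncard hsplit (hS₁fin.union hS₂fin)).trans (ncard_union_le _ _)
  have hsub : S₂ ⊆ ThmN.triangles (M ＼ {x}) := by
    intro C hC
    exact ⟨_root_.Matroid.delete_isCircuit_iff.2 ⟨hC.1, disjoint_singleton_right.2 hC.2.2⟩, hC.2.1⟩
  have hS₂ : S₂.ncard ≤ 6 := by
    have h := (ncard_le_ncard hsub
      ((M ＼ {x}).ground_finite.finite_subsets.subset (fun C hC => hC.1.subset_ground))).trans
      (ncard_triangles_le_triBound6 (M ＼ {x}) hC1' hC2' hd'enc)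
    rw [hd'4] at h
    have h46 : triBound6 4 = 6 := by decide
    rw [h46] at h
    exact h
  have ha : S.ncard ≤ m + 6 := by omega
  -- (b) the star and the double count
  have hstar : 1 + 2 * m ≤ (⋃₀ S).ncard := one_add_two_mul_ncard_trianglesThrough_le M hC1 hx hxU'
  have hdc : (⋃₀ S).ncard * m ≤ 3 * S.ncard := ncard_sUnion_mul_le_three_mul_ncard_triangles M hmin
  have hb : m + 2 * m * m ≤ 3 * S.ncard := by
    have h1 : (1 + 2 * m) * m ≤ (⋃₀ S).ncard * m := Nat.mul_le_mul_right m hstar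
    have h2 : (1 + 2 * m) * m = m + 2 * m * m := by ring
    rw [h2] at h1
    exact h1.trans hdc
  -- the bootstrap's own bound `s₃ ≤ 9`
  have hup : S.ncard ≤ 9 := by
    have h := ncard_triangles_le_triBound6 M hC1 hC2 hd
    have h59 : triBound6 5 = 9 := by decide
    rw [h59] at h
    exact h
  -- (c) if `s₃ ≥ 9` then `s₃ = 9`, `m = 3`, `7 ≤ |U| ≤ 9`
  by_contra hcon
  have hs9 : S.ncard = 9 := by omega
  have hm3 : m = 3 := by
    have hm_ge : 3 ≤ m := by omega
    have hm_le : m ≤ 3 := by nlinarith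
    omega
  have hU9 : (⋃₀ S).ncard ≤ 9 := by
    rw [hm3, hs9] at hdc
    omega
  have hU7 : 7 ≤ (⋃₀ S).ncard := by
    rw [hm3] at hstar
    omega
  -- (d) the restriction step: `|U| = 9`
  have hUcard : (⋃₀ S).ncard = 9 := ncard_sUnion_triangles_eq_nine M hC1 hC2 hs9 hU7 hU9
  -- (e) every point of `U` lies on exactly `3` triangles
  have hall3 : ∀ y ∈ ⋃₀ S, (ThmN.trianglesThrough M y).ncard = 3 := by
    intro y hy
    have h1 := hmin y hy
    rw [hm3] at h1
    by_contra h
    have h2 : 3 < (ThmN.trianglesThrough M y).ncard := lt_of_le_of_ne h1 (Ne.symm h)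
    have h3 : (⋃₀ S).ncard * 3 + 1 ≤ 3 * S.ncard :=
      ncard_sUnion_mul_add_one_le_three_mul_ncard_triangles M (m := 3) (by rw [← hm3]; exact hmin) hy h2
    rw [hUcard, hs9] at h3
    omega
  -- (f) the star of `x`: `s = {C₁, C₂, C₃}`, `7` points; the two points `q, q'` of `U` off the star
  set s : Finset (Set α) := hS₁fin.toFinset with hsdef
  have hs : ∀ C ∈ s, C ∈ ThmN.trianglesThrough M x :=
    fun C hC => (Set.Finite.mem_toFinset hS₁fin).1 hC
  have hs' : ∀ C, C ∈ ThmN.trianglesThrough M x → C ∈ s :=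
    fun C hC => (Set.Finite.mem_toFinset hS₁fin).2 hC
  have hscard : s.card = 3 := by
    rw [hsdef, ← Set.ncard_eq_toFinset_card _ hS₁fin]
    exact hm3
  obtain ⟨-, hstar_card⟩ := ThmN.eRk_le_and_ncard_eq_of_triangles M hC1 hx s hs
  rw [hscard] at hstar_card
  set St := ({x} ∪ ⋃ C ∈ s, C) with hSt
  have hStU : St ⊆ ⋃₀ S := by
    intro z hz
    rcases hz with hz | hz
    · rw [Set.mem_singleton_iff.1 hz]; exact hxU'
    · obtain ⟨C, hC, hzC⟩ := Set.mem_iUnion₂.1 hz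
      exact Set.mem_sUnion.2 ⟨C, ⟨(hs C hC).1, (hs C hC).2.1⟩, hzC⟩
  have hdiff : ((⋃₀ S) \ St).ncard = 2 := by
    calc ((⋃₀ S) \ St).ncard = (⋃₀ S).ncard - St.ncard := Set.ncard_sdiff' hStU hUfin
      _ = 2 := by rw [hUcard, hstar_card]
  obtain ⟨q, q', hqq', hqq'eq⟩ := Set.ncard_eq_two.1 hdiff
  have hqmem : q ∈ (⋃₀ S) \ St := by rw [hqq'eq]; exact Or.inl rfl
  have hq'mem : q' ∈ (⋃₀ S) \ St := by rw [hqq'eq]; exact Or.inr rfl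
  have hqU : q ∈ ⋃₀ S := hqmem.1
  have hq'U : q' ∈ ⋃₀ S := hq'mem.1
  have hqSt : q ∉ St := hqmem.2
  have hq'St : q' ∉ St := hq'mem.2
  have hUeq : ∀ z ∈ ⋃₀ S, z ∈ St ∨ z = q ∨ z = q' := by
    intro z hz
    by_cases h : z ∈ St
    · exact Or.inl h
    · have hz' : z ∈ (⋃₀ S) \ St := ⟨hz, h⟩
      rw [hqq'eq] at hz'
      rcases hz' with h | h
      · exact Or.inr (Or.inl h)
      · exact Or.inr (Or.inr (Set.mem_singleton_iff.1 h))
  have hcover' : ∀ z ∈ ⋃₀ S, z ∈ St ∨ z = q' ∨ z = q := by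
    intro z hz
    rcases hUeq z hz with h | h | h
    · exact Or.inl h
    · exact Or.inr (Or.inr h)
    · exact Or.inr (Or.inl h)
  -- a triangle through a point off the star avoids `x`
  have hTx : ∀ {y : α}, y ∉ St → ∀ T ∈ ThmN.trianglesThrough M y, x ∉ T := by
    intro y hy T hT hxT
    apply hy
    have hTs : T ∈ s := hs' T ⟨hT.1, hT.2.1, hxT⟩
    exact Or.inr (Set.mem_iUnion₂.2 ⟨T, hTs, hT.2.2⟩)
  -- (g) the final contradiction: `q, q' ∈ cl(Cᵢ ∪ Cⱼ)` makes a rank-`≤ 3` set of `7` points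
  have hfinal : ∀ Ci ∈ s, ∀ Cj ∈ s, Ci ≠ Cj → q ∈ M.closure (Ci ∪ Cj) → q' ∈ M.closure (Ci ∪ Cj) → False := by
    intro Ci hCi Cj hCj hij hq hq'
    have hqCC : q ∉ Ci ∪ Cj := by
      intro h
      apply hqSt
      rcases h with h | h
      · exact Or.inr (Set.mem_iUnion₂.2 ⟨Ci, hCi, h⟩)
      · exact Or.inr (Set.mem_iUnion₂.2 ⟨Cj, hCj, h⟩)
    have hq'CC : q' ∉ Ci ∪ Cj := by
      intro h
      apply hq'St
      rcases h with h | h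
      · exact Or.inr (Set.mem_iUnion₂.2 ⟨Ci, hCi, h⟩)
      · exact Or.inr (Set.mem_iUnion₂.2 ⟨Cj, hCj, h⟩)
    exact false_of_two_mem_closure_union_trianglesThrough M hC1 hC2 hx (hs Ci hCi) (hs Cj hCj) hij hqq'
      (hUE hqU) (hUE hq'U) hqCC hq'CC hq hq'
  -- (h) the type-finding step (S1TriangleKernelFiveLemmas)
  have hfind : ∀ y y' : α, y ∈ ⋃₀ S → y ∉ St → y' ∉ St → y ≠ y' →
      (∀ z ∈ ⋃₀ S, z ∈ St ∨ z = y ∨ z = y') →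
      ∀ Ck ∈ s, ∀ (𝒯 : Finset (Set α)), (∀ T ∈ 𝒯, T ∈ ThmN.trianglesThrough M y) → (∀ T ∈ 𝒯, y' ∉ T) →
      ∀ (K : Finset α), (∀ T ∈ 𝒯, T ∩ Ck ⊆ ↑K) → K.card < 𝒯.card →
      ∃ T ∈ 𝒯, T \ {y} ⊆ ⋃ C ∈ s.erase Ck, C := by
    intro y y' _ hySt _ _ hcover Ck hCk 𝒯 h𝒯 h𝒯' K hK hcard
    exact exists_triangle_sdiff_subset_erase M hC1 s hs' hySt
      (fun T hT z hz => hcover z (Set.mem_sUnion.2 ⟨T, ⟨hT.1, hT.2.1⟩, hz⟩)) hCk 𝒯 h𝒯 h𝒯' K hK hcard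
  -- (i) `⋃ (s.erase Ck)` lies in the union of the two other triangles
  obtain ⟨C₁, C₂, C₃, h12, h13, h23, hs3⟩ := Finset.card_eq_three.1 hscard
  have hC₁ : C₁ ∈ s := by rw [hs3]; simp
  have hC₂ : C₂ ∈ s := by rw [hs3]; simp
  have hC₃ : C₃ ∈ s := by rw [hs3]; simp
  have hmem3 : ∀ C ∈ s, C = C₁ ∨ C = C₂ ∨ C = C₃ := by
    intro C hC
    rw [hs3] at hC
    simpa using hC
  have hcl_of : ∀ Ck ∈ s, ∀ Ci ∈ s, ∀ Cj ∈ s, Ci ≠ Cj → (∀ C ∈ s, C ≠ Ck → C = Ci ∨ C = Cj) →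
      q ∈ M.closure (⋃ C ∈ s.erase Ck, C) → q' ∈ M.closure (⋃ C ∈ s.erase Ck, C) → False := by
    intro Ck hCk Ci hCi Cj hCj hij hoth hq hq'
    have hsub : (⋃ C ∈ s.erase Ck, C) ⊆ Ci ∪ Cj := by
      intro z hz
      obtain ⟨C, hC, hzC⟩ := Set.mem_iUnion₂.1 hz
      rcases hoth C (Finset.mem_of_mem_erase hC) (Finset.ne_of_mem_erase hC) with h | h
      · rw [h] at hzC; exact Or.inl hzC
      · rw [h] at hzC; exact Or.inr hzC
    exact hfinal Ci hCi Cj hCj hij (M.closure_subset_closure hsub hq) (M.closure_subset_closure hsub hq')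
  have hcases : ∀ Ck ∈ s, q ∈ M.closure (⋃ C ∈ s.erase Ck, C) → q' ∈ M.closure (⋃ C ∈ s.erase Ck, C) →
      False := by
    intro Ck hCk hq hq'
    rcases hmem3 Ck hCk with h | h | h
    · refine hcl_of Ck hCk C₂ hC₂ C₃ hC₃ h23 ?_ hq hq'
      intro C hC hne
      rcases hmem3 C hC with h' | h' | h'
      · exact absurd (h'.trans h.symm) hne
      · exact Or.inl h'
      · exact Or.inr h'
    · refine hcl_of Ck hCk C₁ hC₁ C₃ hC₃ h13 ?_ hq hq'
      intro C hC hne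
      rcases hmem3 C hC with h' | h' | h'
      · exact Or.inl h'
      · exact absurd (h'.trans h.symm) hne
      · exact Or.inr h'
    · refine hcl_of Ck hCk C₁ hC₁ C₂ hC₂ h12 ?_ hq hq'
      intro C hC hne
      rcases hmem3 C hC with h' | h' | h'
      · exact Or.inl h'
      · exact Or.inr h'
      · exact absurd (h'.trans h.symm) hne
  -- (j) the triangles through `q` and through `q'` as finsets of card `3`
  have hTqfin : (ThmN.trianglesThrough M q).Finite := hSfin.subset (fun C hC => ⟨hC.1, hC.2.1⟩)
  have hTq'fin : (ThmN.trianglesThrough M q').Finite := hSfin.subset (fun C hC => ⟨hC.1, hC.2.1⟩)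
  set 𝒯q := hTqfin.toFinset with h𝒯q
  set 𝒯q' := hTq'fin.toFinset with h𝒯q'
  have hmemq : ∀ T, T ∈ 𝒯q ↔ T ∈ ThmN.trianglesThrough M q := fun T => Set.Finite.mem_toFinset hTqfin
  have hmemq' : ∀ T, T ∈ 𝒯q' ↔ T ∈ ThmN.trianglesThrough M q' := fun T => Set.Finite.mem_toFinset hTq'fin
  have hcardq : 𝒯q.card = 3 := by
    rw [h𝒯q, ← Set.ncard_eq_toFinset_card _ hTqfin]
    exact hall3 q hqU
  have hcardq' : 𝒯q'.card = 3 := by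
    rw [h𝒯q', ← Set.ncard_eq_toFinset_card _ hTq'fin]
    exact hall3 q' hq'U
  have hclosure : ∀ {y : α} {T X : Set α}, T ∈ ThmN.trianglesThrough M y → T \ {y} ⊆ X → y ∈ M.closure X :=
    fun hT hsub => M.closure_subset_closure hsub (hT.1.mem_closure_sdiff_singleton_of_mem hT.2.2)
  by_cases hshared : ∃ T₀ ∈ 𝒯q, q' ∈ T₀
  · -- CASE B: a triangle `T₀ = {q, q', a}` through both, `a ∈ Ck ∖ {x}`
    obtain ⟨T₀, hT₀, hq'T₀⟩ := hshared
    have hT₀q := (hmemq T₀).1 hT₀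
    have hT₀q' : T₀ ∈ ThmN.trianglesThrough M q' := ⟨hT₀q.1, hT₀q.2.1, hq'T₀⟩
    have hT₀fin : T₀.Finite := M.ground_finite.subset hT₀q.1.subset_ground
    have hpairsub : ({q, q'} : Set α) ⊆ T₀ := Set.pair_subset hT₀q.2.2 hq'T₀
    have h1 : (T₀ \ {q, q'}).ncard = 1 := by
      rw [Set.ncard_sdiff' hpairsub hT₀fin, hT₀q.2.1, Set.ncard_pair hqq']
    obtain ⟨a, ha⟩ := Set.ncard_eq_one.1 h1
    have hamem : a ∈ T₀ \ {q, q'} := by rw [ha]; exact Set.mem_singleton a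
    have haT₀ : a ∈ T₀ := hamem.1
    have haq : a ≠ q := fun h => hamem.2 (Or.inl h)
    have haq' : a ≠ q' := fun h => hamem.2 (Or.inr (Set.mem_singleton_iff.2 h))
    have haU : a ∈ ⋃₀ S := Set.mem_sUnion.2 ⟨T₀, ⟨hT₀q.1, hT₀q.2.1⟩, haT₀⟩
    have haSt : a ∈ St := by
      rcases hUeq a haU with h | h | h
      · exact h
      · exact absurd h haq
      · exact absurd h haq'
    have hax : a ≠ x := fun h => hTx hqSt T₀ hT₀q (by rw [← h]; exact haT₀)
    obtain ⟨Ck, hCk, haCk⟩ : ∃ Ck ∈ s, a ∈ Ck := by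
      rcases haSt with h | h
      · exact absurd (Set.mem_singleton_iff.1 h) hax
      · obtain ⟨C, hC, haC⟩ := Set.mem_iUnion₂.1 h
        exact ⟨C, hC, haC⟩
    have hCkfin : Ck.Finite := M.ground_finite.subset (hs Ck hCk).1.subset_ground
    have hxCk : x ∈ Ck := (hs Ck hCk).2.2
    -- `K := Ck ∖ {x, a}`, one point
    set K : Finset α := (hCkfin.toFinset.erase x).erase a with hKdef
    have hKcard : K.card = 1 := by
      rw [hKdef, Finset.card_erase_of_mem, Finset.card_erase_of_mem, ← Set.ncard_eq_toFinset_card _ hCkfin,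
        (hs Ck hCk).2.1]
      · exact (Set.Finite.mem_toFinset hCkfin).2 hxCk
      · exact Finset.mem_erase.2 ⟨hax, (Set.Finite.mem_toFinset hCkfin).2 haCk⟩
    have hKmem : ∀ z, z ∈ (K : Set α) ↔ z ∈ Ck ∧ z ≠ x ∧ z ≠ a := by
      intro z
      rw [hKdef]
      simp only [Finset.coe_erase, Set.Finite.coe_toFinset, Set.mem_sdiff, Set.mem_singleton_iff]
      tauto
    -- the triangles through `q` other than `T₀` avoid `q'` and `a`
    have hfam : ∀ (y y' : α), y ∉ St → T₀ ∈ ThmN.trianglesThrough M y → y' ∈ T₀ → y ≠ y' →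
        ∀ (𝒯y : Finset (Set α)), (∀ T, T ∈ 𝒯y ↔ T ∈ ThmN.trianglesThrough M y) → 𝒯y.card = 3 →
        (∀ T ∈ 𝒯y.erase T₀, T ∈ ThmN.trianglesThrough M y) ∧ (∀ T ∈ 𝒯y.erase T₀, y' ∉ T) ∧
        (∀ T ∈ 𝒯y.erase T₀, T ∩ Ck ⊆ ↑K) ∧ K.card < (𝒯y.erase T₀).card := by
      intro y y' hySt hT₀y hy'T₀ hyy' 𝒯y hmemy hcardy
      have hT₀y' : T₀ ∈ 𝒯y := (hmemy T₀).2 hT₀y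
      have hmem' : ∀ T ∈ 𝒯y.erase T₀, T ∈ ThmN.trianglesThrough M y :=
        fun T hT => (hmemy T).1 (Finset.mem_of_mem_erase hT)
      have hinter : ∀ T ∈ 𝒯y.erase T₀, T ∩ T₀ = {y} := fun T hT =>
        ThmN.inter_eq_singleton_of_mem_trianglesThrough M hC1 (hmem' T hT) hT₀y (Finset.ne_of_mem_erase hT)
      refine ⟨hmem', ?_, ?_, ?_⟩
      · intro T hT hy'T
        have h := hinter T hT
        have : y' ∈ T ∩ T₀ := ⟨hy'T, hy'T₀⟩
        rw [h] at this
        exact hyy' (Set.mem_singleton_iff.1 this).symm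
      · intro T hT z hz
        rw [hKmem]
        refine ⟨hz.2, fun h => hTx hySt T (hmem' T hT) (by rw [← h]; exact hz.1), ?_⟩
        intro h
        have hmem2 : a ∈ T ∩ T₀ := ⟨by rw [← h]; exact hz.1, haT₀⟩
        rw [hinter T hT] at hmem2
        rw [Set.mem_singleton_iff] at hmem2
        exact hySt (by rw [← hmem2]; exact haSt)
      · rw [Finset.card_erase_of_mem hT₀y', hcardy, hKcard]
        norm_num
    obtain ⟨hq1, hq2, hq3, hq4⟩ := hfam q q' hqSt hT₀q hq'T₀ hqq' 𝒯q hmemq hcardq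
    obtain ⟨hq'1, hq'2, hq'3, hq'4⟩ := hfam q' q hq'St hT₀q' hT₀q.2.2 hqq'.symm 𝒯q' hmemq' hcardq'
    obtain ⟨T, hT, hTsub⟩ :=
      hfind q q' hqU hqSt hq'St hqq' hUeq Ck hCk (𝒯q.erase T₀) hq1 hq2 K hq3 hq4
    obtain ⟨T', hT', hT'sub⟩ :=
      hfind q' q hq'U hq'St hqSt hqq'.symm hcover' Ck hCk (𝒯q'.erase T₀) hq'1 hq'2 K hq'3 hq'4
    exact hcases Ck hCk (hclosure (hq1 T hT) hTsub) (hclosure (hq'1 T' hT') hT'sub)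
  · -- CASE A: no triangle contains both `q` and `q'`; `K := C₁ ∖ {x}`, two points
    push Not at hshared
    have hq'q : ∀ T ∈ 𝒯q', q ∉ T := by
      intro T hT hqT
      have hT' := (hmemq' T).1 hT
      exact hshared T ((hmemq T).2 ⟨hT'.1, hT'.2.1, hqT⟩) hT'.2.2
    have hC₁fin : C₁.Finite := M.ground_finite.subset (hs C₁ hC₁).1.subset_ground
    set K : Finset α := hC₁fin.toFinset.erase x with hKdef
    have hKcard : K.card = 2 := by
      rw [hKdef, Finset.card_erase_of_mem ((Set.Finite.mem_toFinset hC₁fin).2 (hs C₁ hC₁).2.2),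
        ← Set.ncard_eq_toFinset_card _ hC₁fin, (hs C₁ hC₁).2.1]
    have hKmem : ∀ z, z ∈ (K : Set α) ↔ z ∈ C₁ ∧ z ≠ x := by
      intro z
      rw [hKdef]
      simp only [Finset.coe_erase, Set.Finite.coe_toFinset, Set.mem_sdiff, Set.mem_singleton_iff]
    have hK : ∀ (y : α), y ∉ St → ∀ T ∈ ThmN.trianglesThrough M y, T ∩ C₁ ⊆ ↑K := by
      intro y hySt T hT z hz
      rw [hKmem]
      exact ⟨hz.2, fun h => hTx hySt T hT (by rw [← h]; exact hz.1)⟩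
    obtain ⟨T, hT, hTsub⟩ := hfind q q' hqU hqSt hq'St hqq' hUeq C₁ hC₁ 𝒯q (fun T hT => (hmemq T).1 hT)
      hshared K (fun T hT => hK q hqSt T ((hmemq T).1 hT)) (by omega)
    obtain ⟨T', hT', hT'sub⟩ := hfind q' q hq'U hq'St hqSt hqq'.symm hcover' C₁ hC₁ 𝒯q'
      (fun T hT => (hmemq' T).1 hT) hq'q K (fun T hT => hK q' hq'St T ((hmemq' T).1 hT)) (by omega)
    exact hcases C₁ hC₁ (hclosure ((hmemq T).1 hT) hTsub) (hclosure ((hmemq' T').1 hT') hT'sub)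

end S1

end PercRepro
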